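import Summits.Schanuel.Schanuel.Theorems.ZilberEacEquivariantCriticalExistence
import Summits.Schanuel.Schanuel.Theorems.ZilberEacEquivariantCriticalGeneric
import Summits.Schanuel.Schanuel.Theorems.ZilberEacDiagonalCriticalElimination
import Summits.Schanuel.Schanuel.Theorems.ZilberEacPunctureDensityPoly
import Mathlib.Analysis.SpecialFunctions.Pow.Asymptotics
import HarnessLib

/-!
# O54 (b)'s literal example `{x₂ = -(x₀-x₁)² + x₀, yⱼ = xⱼ + y₂}` has Zariski dense exponential
# points

Zilber's Exponential-Algebraic Closedness, case ladder (host summit Schanuel, cell `pub-schanuel`,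
seat 2, gen 13).  THE VARIETY (the example named open in O53 (b), O54 (b), O55 (b): equivariant base
with drift `β = 1` — no rotation — at the CRITICAL size):

  `W = {x₂ = -(x₀ - x₁)² + x₀,  y₀ = x₀ + y₂,  y₁ = x₁ + y₂} ⊆ ℂ³ × ℂ³`,

exponential points `e^{z} = z + e^{-(z-w)² + z}`, `e^{w} = w + e^{-(z-w)² + z}`.

**THEOREM (`unprojectedDense_negSqDiffPlusX`).**  `I(W ∩ Γ_exp) = I(W)`.

Proof: diagonal-ray solutions `x(m) = (2πim + log m)(1,1) + v(m)`, `v(m) → v*_k`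
(`ZilberEacEquivariantCriticalExistence`, labels `k ≥ 1`: `e^{v₀*} = E_k = 2πi/(1 - e^{4π²k²})`,
`v₁* = v₀* + 2πik`); along them `x₁ - x₀ → 2πik`, `x₀/m → 2πi`,
`y₂/m → T_k = 2πi e^{4π²k²}/(1 - e^{4π²k²})`, and `T_k → -2πi` super-exponentially fast
(`|T_k + 2πi| = 2π/(e^{4π²k²} - 1)`), so the pairs `(2πik, T_k)` are Zariski-generic
(`ZilberEacEquivariantCriticalGeneric.pairs_generic_of_superpoly_limit`) and THEOREM N₂
(`ZilberEacDiagonalCriticalElimination.unprojectedDense_of_bddLinLin`) concludes.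

Corollary **`negSqDiffPlusX_member_dense`**: all seven hypotheses of `ECCell 3 2`, not linearly
split, `W ∩ Γ_exp ≠ ∅`, DENSE.

HONEST FRAMING: one explicit member of an OPEN cell; `EC(3,2)` OPEN; NOT Schanuel's conjecture;
EAC ⇏ SC.
-/

noncomputable section

open Complex MvPolynomial Filter Topology
open Literature.NumberTheory.Transcendental Literature.ModelTheory.Zilber
  Literature.ModelTheory.ExponentialFields

set_option linter.dupNamespace false

namespace Summit.Schanuel.Schanuel.Theorems

section NegSqDiffPlusX

/-- `deg(-(X₀ - X₁)² + X₀) = 2`. [folklore] -/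
theorem totalDegree_negSqDiffPlusX :
    (-(X 0 - X 1) ^ 2 + X 0 : MvPolynomial (Fin 2) ℂ).totalDegree = 2 := by
  have hsq : ((X 0 - X 1) ^ 2 : MvPolynomial (Fin 2) ℂ).IsHomogeneous 2 :=
    ((isHomogeneous_X ℂ 0).sub (isHomogeneous_X ℂ 1)).pow 2
  have hsq0 : ((X 0 - X 1) ^ 2 : MvPolynomial (Fin 2) ℂ) ≠ 0 := by
    intro h
    have := congrArg (eval ![1, 0]) h
    simp at this
  have hdeg2 : (-(X 0 - X 1) ^ 2 : MvPolynomial (Fin 2) ℂ).totalDegree = 2 := by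
    rw [totalDegree_neg]; exact hsq.totalDegree hsq0
  have hdeg1 : (X 0 : MvPolynomial (Fin 2) ℂ).totalDegree ≤ 1 := by rw [totalDegree_X]
  apply le_antisymm
  · exact (totalDegree_add _ _).trans (max_le hdeg2.le (hdeg1.trans (by norm_num)))
  · by_contra hlt
    push Not at hlt
    have h2 := homogeneousComponent_eq_zero _ _ hlt
    rw [map_add, homogeneousComponent_of_mem hsq.neg, if_pos rfl,
      homogeneousComponent_eq_zero _ _ (hdeg1.trans_lt (by norm_num)), add_zero, neg_eq_zero] at h2
    exact hsq0 h2

/-- The super-exponential approach `k^N · 2π/(e^{4π²k²} - 1) → 0`. [folklore] -/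
theorem tendsto_pow_mul_two_pi_div_exp_sq_sub_one (N : ℕ) :
    Tendsto (fun k : ℕ => (k : ℝ) ^ N * (2 * Real.pi / (Real.exp (4 * Real.pi ^ 2 * (k : ℝ) ^ 2) - 1)))
      atTop (𝓝 0) := by
  have hπ := Real.pi_pos
  have hπ3 : 3 < Real.pi := Real.pi_gt_three
  have hmain := (Real.tendsto_pow_mul_exp_neg_atTop_nhds_zero N).comp tendsto_natCast_atTop_atTop
  have h4 : Tendsto (fun k : ℕ => 4 * Real.pi * ((k : ℝ) ^ N * Real.exp (-(k : ℝ)))) atTop (𝓝 (4 * Real.pi * 0)) :=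
    tendsto_const_nhds.mul hmain
  rw [mul_zero] at h4
  refine squeeze_zero_norm' ?_ h4
  filter_upwards [eventually_ge_atTop 1] with k hk
  have hk1 : (1 : ℝ) ≤ k := by exact_mod_cast hk
  have hexpk : (1 : ℝ) + k ≤ Real.exp k := by
    have := Real.add_one_le_exp (k : ℝ); linarith
  have hle : (k : ℝ) ≤ 4 * Real.pi ^ 2 * (k : ℝ) ^ 2 := by
    have hk2 : (k : ℝ) ≤ (k : ℝ) ^ 2 := by nlinarith [hk1]
    have hπ2 : (1 : ℝ) ≤ 4 * Real.pi ^ 2 := by nlinarith [hπ3]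
    calc (k : ℝ) ≤ (k : ℝ) ^ 2 := hk2
      _ = 1 * (k : ℝ) ^ 2 := (one_mul _).symm
      _ ≤ 4 * Real.pi ^ 2 * (k : ℝ) ^ 2 := mul_le_mul_of_nonneg_right hπ2 (sq_nonneg _)
  have hexp2 : Real.exp k ≤ Real.exp (4 * Real.pi ^ 2 * (k : ℝ) ^ 2) := Real.exp_le_exp.2 hle
  have hden : Real.exp k / 2 ≤ Real.exp (4 * Real.pi ^ 2 * (k : ℝ) ^ 2) - 1 := by linarith
  have hdenpos : 0 < Real.exp (4 * Real.pi ^ 2 * (k : ℝ) ^ 2) - 1 := by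
    have := Real.exp_pos (k : ℝ); linarith
  rw [Real.norm_eq_abs, abs_of_nonneg (by positivity)]
  calc (k : ℝ) ^ N * (2 * Real.pi / (Real.exp (4 * Real.pi ^ 2 * (k : ℝ) ^ 2) - 1))
      ≤ (k : ℝ) ^ N * (2 * Real.pi / (Real.exp k / 2)) := by
        gcongr
    _ = 4 * Real.pi * ((k : ℝ) ^ N * Real.exp (-(k : ℝ))) := by
        rw [Real.exp_neg]; field_simp; ring

/-- **THEOREM (O54 (b)'s example is dense).**  `I(W ∩ Γ_exp) = I(W)` for
`W = {x₂ = -(x₀-x₁)² + x₀, y₀ = x₀ + y₂, y₁ = x₁ + y₂}`.  See the module docstring. (new)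
[cite: MantovaMasser2023, §1 p.5 (the open case dim π(V) = 2 in ℂ³×ℂˣ³)] -/
theorem unprojectedDense_negSqDiffPlusX :
    UnprojectedDense (polyFibredGraph (-(X 0 - X 1) ^ 2 + X 0 : MvPolynomial (Fin 2) ℂ)
      (fun j => X j) (fun _ => (1 : Polynomial ℂ).toMvPolynomial 0)) := by
  classical
  have hπ := Real.pi_pos
  have h2πI : (2 * Real.pi * I : ℂ) ≠ 0 := Complex.two_pi_I_ne_zero
  set g : MvPolynomial (Fin 2) ℂ := -(X 0 - X 1) ^ 2 + X 0 with hg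
  -- the limit ratios `T_k = 2πi w_k/(1 - w_k)`, `w_k = e^{4π²k²}`
  set w : ℕ → ℝ := fun k => Real.exp (4 * Real.pi ^ 2 * (k : ℝ) ^ 2) with hw
  set T : ℕ → ℂ := fun k => 2 * Real.pi * I * (w k : ℂ) / (1 - (w k : ℂ)) with hT
  have hw1 : ∀ k : ℕ, 1 ≤ k → 1 < w k := by
    intro k hk
    simp only [hw]
    exact Real.one_lt_exp_iff.2 (by positivity)
  have hden : ∀ k : ℕ, 1 ≤ k → (1 : ℂ) - (w k : ℂ) ≠ 0 := by
    intro k hk h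
    have : (w k : ℂ) = 1 := by linear_combination -h
    have h' : w k = 1 := by exact_mod_cast this
    linarith [hw1 k hk]
  -- genericity of the pairs `(2πik, T_k)`
  set PS : Set (ℂ × ℂ) := {vt | ∃ k : ℕ, 1 ≤ k ∧ vt = (2 * Real.pi * I * (k : ℂ), T k)} with hPS
  have hTdiff : ∀ k : ℕ, 1 ≤ k → T k - (-(2 * Real.pi * I)) = 2 * Real.pi * I / (1 - (w k : ℂ)) := by
    intro k hk
    simp only [hT]
    field_simp [hden k hk]
    ring
  have hne : ∀ᶠ k : ℕ in atTop, T k ≠ -(2 * Real.pi * I) := by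
    filter_upwards [eventually_ge_atTop 1] with k hk h
    have := hTdiff k hk
    rw [h, sub_self] at this
    exact div_ne_zero h2πI (hden k hk) this.symm
  have hdec : ∀ N : ℕ, Tendsto (fun k : ℕ => (k : ℂ) ^ N * (T k - (-(2 * Real.pi * I)))) atTop (𝓝 0) := by
    intro N
    refine squeeze_zero_norm' ?_ (tendsto_pow_mul_two_pi_div_exp_sq_sub_one N)
    filter_upwards [eventually_ge_atTop 1] with k hk
    rw [hTdiff k hk, norm_mul, norm_pow, Complex.norm_natCast, norm_div]
    have hwpos : 0 < w k - 1 := by linarith [hw1 k hk]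
    have h1 : ‖(1 : ℂ) - (w k : ℂ)‖ = w k - 1 := by
      rw [show (1 : ℂ) - (w k : ℂ) = ((1 - w k : ℝ) : ℂ) by push_cast; ring, Complex.norm_real,
        Real.norm_eq_abs, abs_of_neg (by linarith), neg_sub]
    rw [h1, show ‖(2 * Real.pi * I : ℂ)‖ = 2 * Real.pi by
      simp [abs_of_pos hπ]]
  have hgen : ∀ Q : MvPolynomial (Fin 2) ℂ, Q ≠ 0 → ∃ vt ∈ PS, eval ![vt.1, vt.2] Q ≠ 0 := by
    intro Q hQ
    obtain ⟨k, hk, hne'⟩ := pairs_generic_of_superpoly_limit h2πI hne hdec Q hQ 1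
    exact ⟨_, ⟨k, hk, rfl⟩, hne'⟩
  refine unprojectedDense_of_bddLinLin (isIrreducibleClosed_polyFibredGraph _ _ _)
    (by rw [zariskiDim_polyFibredGraph]) ![Sum.inl 0, Sum.inl 1, Sum.inr (Fin.last 2)]
    (Wst := 2 * Real.pi * I) h2πI hgen ?_
  rintro _ ⟨k, hk, rfl⟩
  -- base point of the label `k`
  set E : ℂ := 2 * Real.pi * I / (1 - (w k : ℂ)) with hE
  have hE0 : E ≠ 0 := div_ne_zero h2πI (hden k hk)
  have hEeq : E * (1 - (w k : ℂ)) = 2 * Real.pi * I := by rw [hE, div_mul_cancel₀ _ (hden k hk)]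
  set vs : ℂ × ℂ := (log E, log E + 2 * Real.pi * I * (k : ℂ)) with hvs
  have heE : exp (log E) = E := Complex.exp_log hE0
  have hek : exp (2 * Real.pi * I * (k : ℂ)) = 1 := by
    have := Complex.exp_int_mul_two_pi_mul_I (k : ℤ)
    rw [← this]; congr 1; push_cast; ring
  have hwexp : ((w k : ℝ) : ℂ) = exp (((4 * Real.pi ^ 2 * (k : ℝ) ^ 2 : ℝ)) : ℂ) := by
    simp only [hw]; rw [Complex.ofReal_exp]
  have hG : exp (-(vs.1 - vs.2) ^ 2 + vs.1) = (w k : ℂ) * E := by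
    simp only [hvs]
    rw [show -(log E - (log E + 2 * Real.pi * I * (k : ℂ))) ^ 2 + log E =
      (((4 * Real.pi ^ 2 * (k : ℝ) ^ 2 : ℝ)) : ℂ) + log E by
        push_cast; linear_combination (-(4 : ℂ) * Real.pi ^ 2 * (k : ℂ) ^ 2) * Complex.I_sq,
      Complex.exp_add, heE, hwexp]
  have h0 : exp vs.1 = 2 * Real.pi * I * ((1 : ℤ) : ℂ) + exp (-(vs.1 - vs.2) ^ 2 + vs.1) := by
    rw [hG]
    simp only [hvs, heE]
    push_cast
    linear_combination hEeq
  have h1 : exp vs.2 = 2 * Real.pi * I * ((1 : ℤ) : ℂ) + exp (-(vs.1 - vs.2) ^ 2 + vs.1) := by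
    rw [hG]
    simp only [hvs]
    rw [Complex.exp_add, heE, hek]
    push_cast
    linear_combination hEeq
  have hTk : T k = (w k : ℂ) * E := by
    simp only [hT, hE]
    field_simp
  -- the solutions
  obtain ⟨x, v, hv, hx0, hx1, hsol⟩ := exists_solutions_equivariantCritical (p := 1) one_ne_zero h0 h1
  set P : ℕ → Fin 3 ⊕ Fin 3 → ℂ := fun m =>
    pgParam g (fun j => X j) (fun _ => (1 : Polynomial ℂ).toMvPolynomial 0) (x m)
      (exp (eval (x m) g)) with hP
  have hv1 : Tendsto (fun m => (v m).1) atTop (𝓝 vs.1) := (continuous_fst.tendsto _).comp hv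
  have hv2 : Tendsto (fun m => (v m).2) atTop (𝓝 vs.2) := (continuous_snd.tendsto _).comp hv
  have hs0 : Tendsto (fun m : ℕ => (((1 / (m : ℝ) : ℝ)) : ℂ)) atTop (𝓝 0) := by
    have h := (continuous_ofReal.tendsto (0 : ℝ)).comp tendsto_one_div_atTop_nhds_zero_nat
    rw [ofReal_zero] at h
    exact h
  have hl0 : Tendsto (fun m : ℕ => (((Real.log m / (m : ℝ) : ℝ)) : ℂ)) atTop (𝓝 0) := by
    have h := (continuous_ofReal.tendsto (0 : ℝ)).comp
      (tendsto_log_pow_div_natCast_comp (d := fun m => m) tendsto_id 1)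
    rw [ofReal_zero] at h
    refine h.congr fun m => ?_
    simp only [Function.comp_apply, pow_one]
  refine ⟨P, fun m => (m : ℝ), ?_, tendsto_natCast_atTop_atTop, ?_, ?_, ?_⟩
  · -- membership, eventually
    filter_upwards [hsol] with m hm
    refine ⟨pgParam_mem _ _ _ _ _, pgParam_mem_expGraph_of_solution g (fun j => X j)
      (fun _ => (1 : Polynomial ℂ).toMvPolynomial 0) fun j => ?_⟩
    rw [MvPolynomial.eval_toMvPolynomial, Polynomial.eval_one, mul_one, eval_X]
    exact hm j
  · -- `x₁ - x₀ → 2πik`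
    have hlim : Tendsto (fun m => (v m).2 - (v m).1) atTop (𝓝 (vs.2 - vs.1)) := hv2.sub hv1
    have e : vs.2 - vs.1 = 2 * Real.pi * I * (k : ℂ) := by simp only [hvs]; ring
    rw [e] at hlim
    refine hlim.congr fun m => ?_
    have e0 : (Sum.inl 0 : Fin 3 ⊕ Fin 3) = Sum.inl (Fin.castSucc (0 : Fin 2)) := rfl
    have e1 : (Sum.inl 1 : Fin 3 ⊕ Fin 3) = Sum.inl (Fin.castSucc (1 : Fin 2)) := rfl
    simp only [hP, Matrix.cons_val_one, Matrix.cons_val_zero, e0, e1, pgParam_inl_castSucc,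
      hx0 m, hx1 m]
    ring
  · -- `x₀ / m → 2πi`
    have hlim : Tendsto (fun m : ℕ => 2 * Real.pi * I + (((Real.log m / (m : ℝ) : ℝ)) : ℂ) +
        (v m).1 * (((1 / (m : ℝ) : ℝ)) : ℂ)) atTop (𝓝 (2 * Real.pi * I + 0 + vs.1 * 0)) :=
      (tendsto_const_nhds.add hl0).add (hv1.mul hs0)
    simp only [add_zero, mul_zero] at hlim
    refine hlim.congr' ?_
    filter_upwards [eventually_ge_atTop 1] with m hm
    have hmC : (m : ℂ) ≠ 0 := by exact_mod_cast (show m ≠ 0 by omega)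
    have e0 : (Sum.inl 0 : Fin 3 ⊕ Fin 3) = Sum.inl (Fin.castSucc (0 : Fin 2)) := rfl
    simp only [hP, Matrix.cons_val_zero, e0, pgParam_inl_castSucc, hx0 m]
    push_cast
    field_simp
  · -- `y₂ / m → w_k E = T k`
    have hlim : Tendsto (fun m => exp (-((v m).1 - (v m).2) ^ 2 + (v m).1)) atTop
        (𝓝 (exp (-(vs.1 - vs.2) ^ 2 + vs.1))) :=
      (Complex.continuous_exp.tendsto _).comp (((hv1.sub hv2).pow 2).neg.add hv1)
    rw [hG, ← hTk] at hlim
    refine hlim.congr' ?_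
    filter_upwards [eventually_ge_atTop 1] with m hm
    have hmpos : (0 : ℝ) < (m : ℝ) := by exact_mod_cast hm
    have hmC : (m : ℂ) ≠ 0 := by exact_mod_cast (show m ≠ 0 by omega)
    have hexpL : exp ((Real.log m : ℝ) : ℂ) = (m : ℂ) := by
      rw [← Complex.ofReal_exp, Real.exp_log hmpos]
      push_cast
      rfl
    have hexpP : exp (2 * Real.pi * I * ((1 : ℤ) : ℂ) * (m : ℂ)) = 1 := by
      have := Complex.exp_int_mul_two_pi_mul_I (m : ℤ)
      rw [← this]; congr 1; push_cast; ring
    have hbase : eval (x m) g = 2 * Real.pi * I * ((1 : ℤ) : ℂ) * (m : ℂ) + ((Real.log m : ℝ) : ℂ) +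
        (-((v m).1 - (v m).2) ^ 2 + (v m).1) := by
      simp only [hg, map_add, map_neg, map_pow, map_sub, eval_X, hx0 m, hx1 m]
      ring
    simp only [hP, Matrix.cons_val_two, Matrix.tail_cons, Matrix.head_cons, pgParam_inr,
      pMulParam_last]
    rw [hbase, Complex.exp_add (2 * Real.pi * I * ((1 : ℤ) : ℂ) * (m : ℂ) + ((Real.log m : ℝ) : ℂ)),
      Complex.exp_add (2 * Real.pi * I * ((1 : ℤ) : ℂ) * (m : ℂ)), hexpP, one_mul, hexpL]
    push_cast
    field_simp

/-- **O54 (b)'s example is a certified member of `EC(3,2)` with dense exponential points.**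
All seven hypotheses of `ECCell 3 2`, not linearly split, `W ∩ Γ_exp ≠ ∅`, `I(W ∩ Γ_exp) = I(W)` for
`W = {x₂ = -(x₀-x₁)² + x₀, y₀ = x₀ + y₂, y₁ = x₁ + y₂}`. (new)
[cite: MantovaMasser2023, §1 p.5 (the open case dim π(V) = 2 in ℂ³×ℂˣ³)] -/
theorem negSqDiffPlusX_member_dense :
    (IsIrreducibleClosed ℂ (polyFibredGraph (-(X 0 - X 1) ^ 2 + X 0 : MvPolynomial (Fin 2) ℂ)
        (fun j => X j) (fun _ => (1 : Polynomial ℂ).toMvPolynomial 0)) ∧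
      (polyFibredGraph (-(X 0 - X 1) ^ 2 + X 0 : MvPolynomial (Fin 2) ℂ)
          (fun j => X j) (fun _ => (1 : Polynomial ℂ).toMvPolynomial 0) ∩ torusLocus ℂ 3).Nonempty ∧
      IsRotund ℂ 3 (polyFibredGraph (-(X 0 - X 1) ^ 2 + X 0 : MvPolynomial (Fin 2) ℂ)
          (fun j => X j) (fun _ => (1 : Polynomial ℂ).toMvPolynomial 0) ∩ torusLocus ℂ 3) ∧
      IsAddFree ℂ 3 (polyFibredGraph (-(X 0 - X 1) ^ 2 + X 0 : MvPolynomial (Fin 2) ℂ)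
          (fun j => X j) (fun _ => (1 : Polynomial ℂ).toMvPolynomial 0) ∩ torusLocus ℂ 3) ∧
      IsMulFree ℂ 3 (polyFibredGraph (-(X 0 - X 1) ^ 2 + X 0 : MvPolynomial (Fin 2) ℂ)
          (fun j => X j) (fun _ => (1 : Polynomial ℂ).toMvPolynomial 0) ∩ torusLocus ℂ 3) ∧
      zariskiDim ℂ (polyFibredGraph (-(X 0 - X 1) ^ 2 + X 0 : MvPolynomial (Fin 2) ℂ)
          (fun j => X j) (fun _ => (1 : Polynomial ℂ).toMvPolynomial 0)) = (3 : ℕ) ∧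
      addProjDim ℂ 3 (polyFibredGraph (-(X 0 - X 1) ^ 2 + X 0 : MvPolynomial (Fin 2) ℂ)
          (fun j => X j) (fun _ => (1 : Polynomial ℂ).toMvPolynomial 0)) = (2 : ℕ)) ∧
    ¬ IsLinearSplit ℂ 3 (polyFibredGraph (-(X 0 - X 1) ^ 2 + X 0 : MvPolynomial (Fin 2) ℂ)
        (fun j => X j) (fun _ => (1 : Polynomial ℂ).toMvPolynomial 0)) ∧
    (polyFibredGraph (-(X 0 - X 1) ^ 2 + X 0 : MvPolynomial (Fin 2) ℂ)
        (fun j => X j) (fun _ => (1 : Polynomial ℂ).toMvPolynomial 0) ∩ expGraph ℂ 3).Nonempty ∧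
    UnprojectedDense (polyFibredGraph (-(X 0 - X 1) ^ 2 + X 0 : MvPolynomial (Fin 2) ℂ)
        (fun j => X j) (fun _ => (1 : Polynomial ℂ).toMvPolynomial 0)) := by
  have hA : Function.Injective (aeval (fun j : Fin 2 => (X j : MvPolynomial (Fin 2) ℂ)) :
      MvPolynomial (Fin 2) ℂ →ₐ[ℂ] MvPolynomial (Fin 2) ℂ) := by
    rw [aeval_X_left]; exact fun _ _ h => h
  have hcell := ecCell_hypotheses_polyFibredGraph (-(X 0 - X 1) ^ 2 + X 0 : MvPolynomial (Fin 2) ℂ)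
    (fun j => X j) (fun _ => (1 : Polynomial ℂ).toMvPolynomial 0) hA
    (by rw [totalDegree_negSqDiffPlusX])
  have hdense := unprojectedDense_negSqDiffPlusX
  refine ⟨hcell, not_isLinearSplit_polyFibredGraph _ (fun j => X j) _ (by norm_num) hA, ?_,
    hdense⟩
  obtain ⟨w, hw, -⟩ := hcell.2.1
  exact inter_expGraph_nonempty_of_vanishingIdeal_eq ⟨w, hw⟩ hdense

end NegSqDiffPlusX

end Summit.Schanuel.Schanuel.Theorems

end
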